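import Summits.Ventures.Crystal3D.Theorems.StickyWulffConstantCoaxialWallLawMidPlanarFrame
import Summits.Ventures.Crystal3D.Theorems.StickyWulffConstantCoaxialWallLawMidPlanarCert
import Summits.Ventures.Crystal3D.Theorems.StickyWulffConstantCoaxialWallLawBiPlanarRowHalf
import HarnessLib

/-!
# The planar-heights kissing row HOLDS for every offset `τ ∈ [0.345, 0.655]`, and the (F-γ) bi-planar rung on that interval

HONEST FRAMING. Part of the venture `Summits/Ventures/Crystal3D` (cell `crystal3d-full`), helper
`--supports` the crux `CoaxialWallLaw` (stmt-Ventures-19481, `route-Ventures-StickyWulffConstant`),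
REGISTERED line `WallLedgerF`, open stub `stub_coaxialTwoSlabAdhesion`.  RUNG CREDIT ONLY; F-C1 not moved.

The INTERVAL version of `…BiPlanarRowHalf` (offset `½` only): ONE integer table `mpTbl` (`…MidPlanarKey`) is a sound
lower bound of the azimuth separations for EVERY `τ ∈ [0.345, 0.655]` and still refutes every 12-point species pattern.

* `midPlanar_card_le_eleven` — for `τ ∈ [0.345, 0.655]`: unit vectors pairwise `≥ 1` apart with frame heights in
  `√(2/3)·(ℤ ∪ (ℤ + τ))`, containing the in-plane `−d` and not `d`, number `≤ 11`.  Certificate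
  `mp_cert_kernel : azSearchF mpTbl 62832 [5,12,12,12,12] 0 12 = true` (`…MidPlanarCert`, KERNEL GRADE: 25 `decide +kernel`
  sub-certificates `…MidPlanarCertA … J`), sound by `azSearchF_sound`.
* `biPlanarEndRow_mid`, `biPlanarEndRow_add_intCast`, `biPlanarEndRow_of_frac_mem` — `BiPlanarEndRow τ` for every `τ`
  whose fractional offset lies in `[0.345, 0.655]`.
* **`coaxialTwoSlabAdhesion_biPlanar_mid`** — the (F-γ) BI-PLANAR RUNG ON THE INTERVAL: every co-axial pair whose frame
  offset is within `0.155` layer spacings of the half-layer offset (`(L⁻¹(s₂ − s₁))₂ = (n + τ)√(2/3)`,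
  `τ ∈ [0.345, 0.655]`), every bi-planar filling ⇒ the stub's inequality at `√6/4 ≥ ½`.

WHAT THIS IS NOT: offsets outside the interval (margins → 0 at `τ → 0, ⅓, ⅔, 1`; the row is false at `⅓, ⅔`);
general fillings; F-C1 not moved.
-/

noncomputable section

namespace Summit.Ventures.Crystal3D.Theorems

open Finset Real
open Literature.Algebra.EuclideanLattices (inner_fin_three)
open Literature.MathematicalPhysics.StatisticalMechanics (fccStacking barlowStacking IsHaggSeq contactDeficiency)
open scoped InnerProductSpace

/-! ## Species of a member -/

/-- The species index of a height at offset `τ`. -/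
def mpSp (τ h : ℝ) : ℕ :=
  if h = 0 then 0 else if h = τ * Real.sqrt (2 / 3) then 1
  else if h = (τ - 1) * Real.sqrt (2 / 3) then 2 else if h = Real.sqrt (2 / 3) then 3 else 4

/-- Species indices are `< 5`. -/
theorem mpSp_lt (τ h : ℝ) : mpSp τ h < 5 := by
  unfold mpSp; split_ifs <;> norm_num

/-- A height in `√(2/3)·(ℤ ∪ (ℤ + τ))` with `|·| ≤ 1`, `τ ∈ [0.345, 0.655]`, is one of the five species heights. -/
theorem mpH_mpSp {τ h : ℝ} (hτ0 : 0.345 ≤ τ) (hτ1 : τ ≤ 0.655)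
    (hh : ∃ k : ℤ, h = k * Real.sqrt (2 / 3) ∨ h = (k + τ) * Real.sqrt (2 / 3)) (habs : |h| ≤ 1) :
    mpH τ (mpSp τ h) = h := by
  have hs := hp_sqrt23_sq
  have hspos : 0 < Real.sqrt (2 / 3) := Real.sqrt_pos.2 (by norm_num)
  have hsq1 : h ^ 2 ≤ 1 := by
    have := abs_le.1 habs; nlinarith [this.1, this.2]
  obtain ⟨k, hk | hk⟩ := hh
  · -- on a grain-1 plane: k ∈ {-1, 0, 1}
    have hk2 : (k : ℝ) ^ 2 ≤ 3 / 2 := by rw [hk] at hsq1; nlinarith [hsq1, hs]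
    have hklt : (k : ℝ) < 2 := by nlinarith
    have hkgt : (-2 : ℝ) < k := by nlinarith
    have hk1 : k < 2 := by exact_mod_cast hklt
    have hk2' : -2 < k := by exact_mod_cast hkgt
    unfold mpSp
    rcases (show k = -1 ∨ k = 0 ∨ k = 1 by omega) with rfl | rfl | rfl
    · have hj' : h = -Real.sqrt (2 / 3) := by rw [hk]; push_cast; ring
      rw [hj', if_neg (by linarith), if_neg (by nlinarith), if_neg (by nlinarith), if_neg (by linarith), mpH_4]
    · have hj' : h = 0 := by rw [hk]; push_cast; ring
      rw [hj', if_pos rfl, mpH_0]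
    · have hj' : h = Real.sqrt (2 / 3) := by rw [hk]; push_cast; ring
      rw [hj', if_neg (by linarith), if_neg (by nlinarith), if_neg (by nlinarith), if_pos rfl, mpH_3]
  · -- on a grain-2 plane: k ∈ {-1, 0}
    have hk2 : ((k : ℝ) + τ) ^ 2 ≤ 3 / 2 := by rw [hk] at hsq1; nlinarith [hsq1, hs]
    have hklt : (k : ℝ) < 1 := by nlinarith
    have hkgt : (-2 : ℝ) < k := by nlinarith
    have hk1 : k < 1 := by exact_mod_cast hklt
    have hk2' : -2 < k := by exact_mod_cast hkgt
    unfold mpSp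
    rcases (show k = -1 ∨ k = 0 by omega) with rfl | rfl
    · have hj' : h = (τ - 1) * Real.sqrt (2 / 3) := by rw [hk]; push_cast; ring
      rw [hj', if_neg (by nlinarith), if_neg (by nlinarith), if_pos rfl, mpH_2]
    · have hj' : h = τ * Real.sqrt (2 / 3) := by rw [hk]; push_cast; ring
      rw [hj', if_neg (by positivity), if_pos rfl, mpH_1]

/-- Species `0` is exactly height `0`. -/
theorem mpSp_eq_zero_iff {τ h : ℝ} (hH : mpH τ (mpSp τ h) = h) :
    mpSp τ h = 0 ↔ h = 0 := by
  constructor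
  · intro h0; rw [← hH, h0, mpH_0]
  · intro h0; unfold mpSp; rw [if_pos h0]

/-! ## The certificate

The certificate is `mp_cert_kernel` (`…MidPlanarCert`, kernel grade). -/

/-! ## The row on the interval -/

/-- **The planar-heights kissing row holds for every offset `τ ∈ [0.345, 0.655]`**: a finite set `S` of unit
vectors, pairwise at distance `≥ 1`, each at frame height in `√(2/3)·(ℤ ∪ (ℤ + τ))` along the unit axis `m`,
containing the in-plane unit vector `−d` and not `d`, has at most `11` members. -/
theorem midPlanar_card_le_eleven {τ : ℝ} (hτ0 : 0.345 ≤ τ) (hτ1 : τ ≤ 0.655)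
    (m d : EuclideanSpace ℝ (Fin 3)) (S : Finset (EuclideanSpace ℝ (Fin 3)))
    (hm : ‖m‖ = 1) (hd : ‖d‖ = 1) (hdm : ⟪d, m⟫_ℝ = 0)
    (h1 : ∀ v ∈ S, ‖v‖ = 1)
    (hh : ∀ v ∈ S, ∃ k : ℤ, ⟪v, m⟫_ℝ = k * Real.sqrt (2 / 3) ∨ ⟪v, m⟫_ℝ = (k + τ) * Real.sqrt (2 / 3))
    (hsep : ∀ v ∈ S, ∀ w ∈ S, v ≠ w → 1 ≤ dist v w)
    (hneg : -d ∈ S) (hpos : d ∉ S) : S.card ≤ 11 := by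
  classical
  by_contra hlt
  push Not at hlt
  set e : EuclideanSpace ℝ (Fin 3) := -d with hedef
  have he : ‖e‖ = 1 := by rw [hedef, norm_neg, hd]
  have hme : ⟪e, m⟫_ℝ = 0 := by rw [hedef, inner_neg_left, hdm, neg_zero]
  -- species heights of members
  have hspec : ∀ v ∈ S, mpH τ (mpSp τ ⟪v, m⟫_ℝ) = ⟪v, m⟫_ℝ := by
    intro v hv
    have habs : |⟪v, m⟫_ℝ| ≤ 1 := by
      have := abs_real_inner_le_norm v m
      rw [h1 v hv, hm, one_mul] at this
      exact this
    exact mpH_mpSp hτ0 hτ1 (hh v hv) habs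
  -- at most five members at height 0 (hexagon rigidity)
  set S₀ : Finset (EuclideanSpace ℝ (Fin 3)) := S.filter fun v => ⟪v, m⟫_ℝ = 0 with hS₀
  have hS₀5 : S₀.card ≤ 5 := by
    by_contra h6
    push Not at h6
    have hanti := inPlane_six_antipode (n := m) (a := e) hm S₀
      (fun u hu => h1 u (mem_filter.1 hu).1) (fun u hu => (mem_filter.1 hu).2)
      (by
        intro u hu u' hu' hne
        have hu1 := h1 u (mem_filter.1 hu).1
        have hu'1 := h1 u' (mem_filter.1 hu').1
        have hdd := hsep u (mem_filter.1 hu).1 u' (mem_filter.1 hu').1 hne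
        have hsq : ‖u - u'‖ ^ 2 = ‖u‖ ^ 2 - 2 * ⟪u, u'⟫_ℝ + ‖u'‖ ^ 2 := norm_sub_sq_real u u'
        rw [hu1, hu'1] at hsq
        rw [dist_eq_norm] at hdd
        nlinarith [hsq, hdd])
      h6 (mem_filter.2 ⟨hneg, hme⟩)
    have : d ∈ S := (mem_filter.1 (by rwa [hedef, neg_neg] at hanti)).1
    exact hpos this
  -- an 11-subset of `S \ {e}`, sorted by azimuth
  have h11 : 11 ≤ (S.erase e).card := by rw [card_erase_of_mem hneg]; omega
  obtain ⟨T, hTsub, hTcard⟩ := Finset.exists_subset_card_eq h11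
  have hTS : ∀ w ∈ T, w ∈ S := fun w hw => mem_of_mem_erase (hTsub hw)
  have hTne : ∀ w ∈ T, w ≠ e := fun w hw => ne_of_mem_erase (hTsub hw)
  let r : EuclideanSpace ℝ (Fin 3) → EuclideanSpace ℝ (Fin 3) → Prop := fun v w => hpAz m e v ≤ hpAz m e w
  haveI : Std.Total r := ⟨fun v w => le_total _ _⟩
  haveI : IsTrans (EuclideanSpace ℝ (Fin 3)) r := ⟨fun a b c hab hbc => le_trans hab hbc⟩
  set L : List (EuclideanSpace ℝ (Fin 3)) := T.toList.insertionSort r with hLdef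
  have hLperm : L.Perm T.toList := List.perm_insertionSort r _
  have hLlen : L.length = 11 := by rw [hLperm.length_eq, Finset.length_toList, hTcard]
  have hLnodup : L.Nodup := hLperm.nodup_iff.2 (Finset.nodup_toList T)
  have hLmem : ∀ x, x ∈ L ↔ x ∈ T := fun x => by rw [hLperm.mem_iff, Finset.mem_toList]
  have hLsorted : L.Pairwise r := List.pairwise_insertionSort r _
  -- the sequence: `e` first, then `L`
  let seq : ℕ → EuclideanSpace ℝ (Fin 3) := fun i => if i = 0 then e else L.getD (i - 1) 0
  have hseq0 : seq 0 = e := by simp [seq]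
  have hseqS : ∀ i (hi : 1 ≤ i) (hi12 : i < 12), seq i = L[i - 1]'(by rw [hLlen]; omega) := by
    intro i hi hi12
    have : seq i = L.getD (i - 1) 0 := by simp [seq, show i ≠ 0 by omega]
    rw [this, List.getD_eq_getElem]
  have hmemS : ∀ i, i < 12 → seq i ∈ S := by
    intro i hi
    by_cases h0 : i = 0
    · rw [h0, hseq0]; exact hneg
    · rw [hseqS i (by omega) hi]
      exact hTS _ ((hLmem _).1 (List.getElem_mem _))
  have hneS : ∀ i, 1 ≤ i → i < 12 → seq i ≠ e := by
    intro i hi hi12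
    rw [hseqS i hi hi12]
    exact hTne _ ((hLmem _).1 (List.getElem_mem _))
  have hinj : ∀ i j, i < j → j < 12 → seq i ≠ seq j := by
    intro i j hij hj heq
    by_cases h0 : i = 0
    · rw [h0, hseq0] at heq
      exact hneS j (by omega) hj heq.symm
    · rw [hseqS i (by omega) (by omega), hseqS j (by omega) hj] at heq
      have := (hLnodup.getElem_inj_iff).1 heq
      omega
  have hle : ∀ i j, i < j → j < 12 → hpAz m e (seq i) ≤ hpAz m e (seq j) := by
    intro i j hij hj
    by_cases h0 : i = 0
    · rw [h0, hseq0, hpAz_self he]; exact hpAz_nonneg _ _ _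
    · rw [hseqS i (by omega) (by omega), hseqS j (by omega) hj]
      exact (List.pairwise_iff_getElem.1 hLsorted) (i - 1) (j - 1) _ _ (by omega)
  -- species and positions
  let sp : ℕ → ℕ := fun i => mpSp τ ⟪seq i, m⟫_ℝ
  let θ : ℕ → ℝ := fun i => 10000 * hpAz m e (seq i)
  have h2π : 10000 * (2 * π) ≤ (62832 : ℝ) := by
    have := Real.pi_lt_d4; nlinarith
  refine azSearchF_sound mp_cert_kernel (by norm_num) sp θ (fun i _ => mpSp_lt τ _) ?_ ?_ ?_ ?_
  · -- root species
    show mpSp τ ⟪seq 0, m⟫_ℝ = 0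
    rw [hseq0, hme]; unfold mpSp; rw [if_pos rfl]
  · -- positions are measured from `e`
    intro i hi
    show 10000 * hpAz m e (seq 0) ≤ 10000 * hpAz m e (seq i)
    rw [hseq0, hpAz_self he]
    have := hpAz_nonneg m e (seq i)
    nlinarith
  · -- separations
    intro i j hij hj
    have hi12 : i < 12 := by omega
    have hv := hmemS i hi12
    have hw := hmemS j hj
    have hpair := mp_pair hτ0 hτ1 hm he hme (h1 _ hv) (h1 _ hw) (mpSp_lt τ _) (mpSp_lt τ _)
      (hspec _ hv).symm (hspec _ hw).symm (hsep _ hv _ hw (hinj i j hij hj)) (hle i j hij hj)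
    have htbl := mp_tbl (sp i) (sp j) (mpSp_lt τ _) (mpSp_lt τ _)
    obtain ⟨hp1, hp2⟩ := hpair
    show ((azGet mpTbl (sp i) (sp j) : ℤ) : ℝ) ≤ 10000 * hpAz m e (seq j) - 10000 * hpAz m e (seq i) ∧
      ((azGet mpTbl (sp i) (sp j) : ℤ) : ℝ) ≤ 10000 * hpAz m e (seq i) + 62832 - 10000 * hpAz m e (seq j)
    constructor <;> nlinarith [hp1, hp2, htbl, h2π]
  · -- caps
    intro a
    by_cases ha0 : a = 0
    · subst ha0
      show ((List.range 12).map sp).count 0 ≤ 5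
      rw [count_map_range_eq_card]
      refine le_trans ?_ hS₀5
      refine Finset.card_le_card_of_injOn seq ?_ ?_
      · intro i hi
        obtain ⟨hi12, hsi⟩ := Finset.mem_filter.1 (Finset.mem_coe.1 hi)
        rw [Finset.mem_range] at hi12
        have hv := hmemS i hi12
        have h0 : ⟪seq i, m⟫_ℝ = 0 := (mpSp_eq_zero_iff (hspec _ hv)).1 hsi
        exact Finset.mem_coe.2 (mem_filter.2 ⟨hv, h0⟩)
      · intro i hi j hj hij
        have hi12 : i < 12 := Finset.mem_range.1 (Finset.mem_filter.1 (Finset.mem_coe.1 hi)).1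
        have hj12 : j < 12 := Finset.mem_range.1 (Finset.mem_filter.1 (Finset.mem_coe.1 hj)).1
        by_contra hne
        rcases Nat.lt_or_gt_of_ne hne with hlt' | hlt'
        · exact hinj i j hlt' hj12 hij
        · exact hinj j i hlt' hi12 hij.symm
    · by_cases ha5 : a < 5
      · have hcap : [5, 12, 12, 12, 12].getD a 0 = 12 := by
          interval_cases a <;> simp at ha0 ⊢
        rw [hcap]
        exact le_trans List.count_le_length (by simp)
      · have hcap : [5, 12, 12, 12, 12].getD a 0 = 0 := by
          rw [List.getD_eq_default]; simp; omega
        rw [hcap, Nat.le_zero, List.count_eq_zero]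
        intro hmem
        obtain ⟨i, -, hi⟩ := List.mem_map.1 hmem
        have := mpSp_lt τ ⟪seq i, m⟫_ℝ
        change sp i < 5 at this
        omega


/-- **`BiPlanarEndRow τ` for every `τ ∈ [0.345, 0.655]`** (`…BiPlanarRowDefs`). -/
theorem biPlanarEndRow_mid {τ : ℝ} (hτ0 : 0.345 ≤ τ) (hτ1 : τ ≤ 0.655) : BiPlanarEndRow τ :=
  fun m d S hm hd hdm h1 hh hsep hneg hpos =>
    midPlanar_card_le_eleven hτ0 hτ1 m d S hm hd hdm h1 hh hsep hneg hpos

/-- The row only depends on the offset modulo `1`. -/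
theorem biPlanarEndRow_add_intCast {τ : ℝ} (n : ℤ) (h : BiPlanarEndRow τ) : BiPlanarEndRow (τ + n) := by
  intro m d S hm hd hdm h1 hh hsep hneg hpos
  refine h m d S hm hd hdm h1 ?_ hsep hneg hpos
  intro v hv
  obtain ⟨k, hk | hk⟩ := hh v hv
  · exact ⟨k, Or.inl hk⟩
  · exact ⟨k + n, Or.inr (by rw [hk]; push_cast; ring)⟩

/-- **`BiPlanarEndRow τ` whenever the fractional offset lies in `[0.345, 0.655]`.** -/
theorem biPlanarEndRow_of_frac_mem {τ : ℝ} (n : ℤ) (hτ0 : 0.345 ≤ τ - n) (hτ1 : τ - n ≤ 0.655) :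
    BiPlanarEndRow τ := by
  have h := biPlanarEndRow_add_intCast n (biPlanarEndRow_mid hτ0 hτ1)
  simpa using h

/-! ## The (F-γ) bi-planar rung on the interval -/

open scoped Classical in
/-- **The (F-γ) BI-PLANAR rung of `stub_coaxialTwoSlabAdhesion` for offsets within `0.155` of the half-layer offset**
(explicit frame, constant `√6/4 ≥ ½`): `(L⁻¹(s₂ − s₁))₂ = (n + τ)·√(2/3)` with `τ ∈ [0.345, 0.655]` ⇒ every filling
with every ball on a basal plane of grain 1 or of grain 2 satisfies
`cross ≤ D(Y) + (φ₁ + φ₂ − (√6/4)·sin θ)πρ² + C(1+h)ρ`. -/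
theorem coaxialTwoSlabAdhesion_biPlanar_mid
    (A₁ : EuclideanSpace ℝ (Fin 3) ≃ₗᵢ[ℝ] EuclideanSpace ℝ (Fin 3)) (t₁ : EuclideanSpace ℝ (Fin 3))
    (A₂ : EuclideanSpace ℝ (Fin 3) ≃ₗᵢ[ℝ] EuclideanSpace ℝ (Fin 3)) (t₂ : EuclideanSpace ℝ (Fin 3))
    (L : EuclideanSpace ℝ (Fin 3) ≃ₗᵢ[ℝ] EuclideanSpace ℝ (Fin 3)) (s₁ s₂ : EuclideanSpace ℝ (Fin 3))
    {σ σ' : ℤ → ℤ} (hσ : IsHaggSeq σ) (hσ' : IsHaggSeq σ')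
    (hsub₁ : (fun p => A₁ p + t₁) '' fccStacking 1 (Real.sqrt (2 / 3)) ⊆
      (fun p => L p + s₁) '' barlowStacking 1 (Real.sqrt (2 / 3)) σ)
    (hsub₂ : (fun p => A₂ p + t₂) '' fccStacking 1 (Real.sqrt (2 / 3)) ⊆
      (fun p => L p + s₂) '' barlowStacking 1 (Real.sqrt (2 / 3)) σ')
    {n : ℤ} {τ : ℝ} (hτ0 : 0.345 ≤ τ) (hτ1 : τ ≤ 0.655)
    (hoff : (L.symm (s₂ - s₁)) 2 = (n + τ) * Real.sqrt (2 / 3)) :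
    ∃ C : ℝ, ∀ h : ℝ, 0 ≤ h → ∀ ρ : ℝ, 10 ≤ ρ →
      ∀ X P₁ P₂ : Finset (EuclideanSpace ℝ (Fin 3)),
      (∀ p ∈ X, ∀ q ∈ X, p ≠ q → 1 ≤ dist p q) → P₁ ⊆ X → P₂ ⊆ X \ P₁ →
      (∀ p ∈ X, -(2 * 10) ≤ p 2 ∧ p 2 ≤ h + 2 * 10 ∧ p 0 ^ 2 + p 1 ^ 2 ≤ ρ ^ 2) →
      (∀ p, p ∈ P₁ ↔ (p ∈ (fun q => A₁ q + t₁) '' fccStacking 1 (Real.sqrt (2 / 3)) ∧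
        -(2 * 10) ≤ p 2 ∧ p 2 ≤ -10 ∧ p 0 ^ 2 + p 1 ^ 2 ≤ ρ ^ 2)) →
      (∀ p, p ∈ P₂ ↔ (p ∈ (fun q => A₂ q + t₂) '' fccStacking 1 (Real.sqrt (2 / 3)) ∧
        h + 10 ≤ p 2 ∧ p 2 ≤ h + 2 * 10 ∧ p 0 ^ 2 + p 1 ^ 2 ≤ ρ ^ 2)) →
      (∀ p ∈ X, (∃ k : ℤ, (L.symm (p - s₁)) 2 = k * Real.sqrt (2 / 3)) ∨
        (∃ k : ℤ, (L.symm (p - s₂)) 2 = k * Real.sqrt (2 / 3))) →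
      ((((P₁ ×ˢ (X \ P₁)).filter fun pq => dist pq.1 pq.2 = 1).card : ℕ) : ℝ) +
        ((((P₂ ×ˢ ((X \ P₁) \ P₂)).filter fun pq => dist pq.1 pq.2 = 1).card : ℕ) : ℝ) ≤
        contactDeficiency ((X \ P₁) \ P₂) +
          (Real.sqrt 2 / 4 * ∑ᶠ w ∈ {w ∈ fccStacking 1 (Real.sqrt (2 / 3)) | ‖w‖ = 1},
              |⟪w, A₁.symm (EuclideanSpace.single (2 : Fin 3) (1 : ℝ))⟫_ℝ| +
            Real.sqrt 2 / 4 * ∑ᶠ w ∈ {w ∈ fccStacking 1 (Real.sqrt (2 / 3)) | ‖w‖ = 1},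
              |⟪w, A₂.symm (EuclideanSpace.single (2 : Fin 3) (1 : ℝ))⟫_ℝ| -
            (Real.sqrt 6 / 4 : ℝ) * Real.sqrt (1 - ⟪L (EuclideanSpace.single (2 : Fin 3) (1 : ℝ)),
              (EuclideanSpace.single (2 : Fin 3) (1 : ℝ))⟫_ℝ ^ 2)) * Real.pi * ρ ^ 2 +
          C * (1 + h) * ρ := by
  have hs0 : 0 < Real.sqrt (2 / 3) := Real.sqrt_pos.2 (by norm_num)
  have hinc : ¬ ∃ k : ℤ, (L.symm (s₂ - s₁)) 2 = k * Real.sqrt (2 / 3) := by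
    rintro ⟨k, hk⟩
    rw [hoff] at hk
    have h1 : ((n : ℝ) + τ) = k := mul_right_cancel₀ hs0.ne' hk
    have h2 : τ = ((k - n : ℤ) : ℝ) := by push_cast; linarith
    -- an integer cannot lie in [0.345, 0.655]
    have h3 : (0.345 : ℝ) ≤ ((k - n : ℤ) : ℝ) := by rw [← h2]; exact hτ0
    have h4 : ((k - n : ℤ) : ℝ) ≤ 0.655 := by rw [← h2]; exact hτ1
    have h5 : (0 : ℤ) < k - n := by
      have : (0 : ℝ) < ((k - n : ℤ) : ℝ) := by linarith
      exact_mod_cast this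
    have h6 : k - n < (1 : ℤ) := by
      have : ((k - n : ℤ) : ℝ) < 1 := by linarith
      exact_mod_cast this
    omega
  have hτeq : (L.symm (s₂ - s₁)) 2 / Real.sqrt (2 / 3) = n + τ := by
    rw [hoff, mul_div_cancel_right₀ _ hs0.ne']
  have hrow : BiPlanarEndRow ((L.symm (s₂ - s₁)) 2 / Real.sqrt (2 / 3)) := by
    rw [hτeq]
    exact biPlanarEndRow_of_frac_mem n (by simpa using hτ0) (by simpa using hτ1)
  exact coaxialTwoSlabAdhesion_biPlanar_of_row A₁ t₁ A₂ t₂ L s₁ s₂ hσ hσ' hsub₁ hsub₂ hinc hrow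

end Summit.Ventures.Crystal3D.Theorems

end
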